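import Literature.Claims.NS.Alneel2026
import Summits.NavierStokesRegularity.NavierStokesRegularity.Theorems.SoloRefuteTarver2016ClaySwirl
import HarnessLib

/-!
# C156 `Alneel2026` — the printed identification «This is exactly Clay Problem A: u₀ ∈ C_c^∞(ℝ³)»
# (§1 p.1 l.31–41), typed as `Literature.Claims.NS.Alneel2026.ClayDelta` («every admissible datum is
# compactly supported»), is FALSE: kernel certificate for the CLAY-LINK column (records-grade)

Cell `ns-claims` (D-0090), row C156 (#145). The skeleton's Clay link for the PRINTED `C_c^∞` face runs
through `clay_of_claimed_of_delta (hΔ : ClayDelta) (h : ClaimedTheorem)`; the typist recorded `ClayDelta`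
as false (Schwartz, non-compactly-supported fields). This file proves it: the tree's Gaussian swirl
`swirl0 x = e^{−|x|²} • (−x₁, x₀, 0)` (Tarver C80 model file) is smooth, divergence free, has every
derivative in `L²` (rapid decay, `HasRapidSpatialDecay.lintegral_enorm_iteratedFDeriv_sq_lt_top`) — so it
is an admissible datum `Alneel2026.IsDatum` — and is NOT compactly supported (it is non-zero at
`(R, 0, 0)` for every `R`). Nothing here touches the row's token / class / locator (#145: FL @
`Step_P3tail`); the abstract-face link `clay_of_claimedH` is unconditional and unaffected.

* `not_clayDelta : ¬ Literature.Claims.NS.Alneel2026.ClayDelta`.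

WHAT THIS IS NOT: not a claim about NS regularity or blow-up; not a claim about any author beyond the
typed locator.
-/

noncomputable section

set_option linter.dupNamespace false

open Set Function
open Literature.Analysis.FluidPDE Literature.Claims.NS
open Literature.Claims.NS.Chae2007 (IsDatum)

namespace Summit.NavierStokesRegularity.NavierStokesRegularity.Theorems.Alneel2026ClayDelta

open Summit.NavierStokesRegularity.NavierStokesRegularity.Theorems.Tarver2016 (swirl0 gauss contDiff_swirl0
  hasRapidSpatialDecay_swirl0 isDivFree_swirl0 gauss_apply)

/-- The Gaussian swirl is an admissible datum of the abstract class of C156 (smooth, divergence free,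
every derivative square-integrable — the C119 class `Chae2007.IsDatum` that C156 uses). [folklore] -/
theorem isDatum_swirl0 : IsDatum swirl0 :=
  ⟨contDiff_swirl0, fun x => isDivFree_swirl0 x,
    fun n => hasRapidSpatialDecay_swirl0.lintegral_enorm_iteratedFDeriv_sq_lt_top n⟩

/-- The Gaussian swirl does not vanish at `(R, 0, 0)`, `R ≠ 0`: its second component there is
`e^{−R²} R`. [folklore] -/
theorem swirl0_ne_zero {R : ℝ} (hR : R ≠ 0) : swirl0 (EuclideanSpace.single 0 R) ≠ 0 := by
  intro h
  have h1 := congrArg (fun v : EuclideanSpace ℝ (Fin 3) => v 1) h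
  simp only [swirl0, PiLp.smul_apply, smul_eq_mul, rotGen_apply_one, EuclideanSpace.single,
    PiLp.single_apply, PiLp.zero_apply, if_true] at h1
  rcases mul_eq_zero.1 h1 with h2 | h2
  · exact (Real.exp_pos _).ne' (by rw [gauss_apply] at h2; exact h2)
  · exact hR h2

/-- The Gaussian swirl is NOT compactly supported. [folklore] -/
theorem not_hasCompactSupport_swirl0 : ¬ HasCompactSupport swirl0 := by
  intro hc
  obtain ⟨R, hR⟩ := (hc.isCompact.isBounded).subset_closedBall (0 : EuclideanSpace ℝ (Fin 3))
  set x : EuclideanSpace ℝ (Fin 3) := EuclideanSpace.single 0 (|R| + 1) with hx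
  have hne : swirl0 x ≠ 0 := swirl0_ne_zero (by positivity)
  have hmem : x ∈ tsupport swirl0 := subset_tsupport _ (Function.mem_support.2 hne)
  have hball := hR hmem
  rw [Metric.mem_closedBall, dist_zero_right, hx, EuclideanSpace.single, PiLp.norm_single,
    Real.norm_eq_abs, abs_of_pos (by positivity)] at hball
  linarith [abs_nonneg R, le_abs_self R]

/-- **`ClayDelta` is false**: the admissible (indeed Clay-class (4)) datum `swirl0` is not compactly
supported, so «every admissible datum is compactly supported» fails — the printed identification of Clay
Problem A's data with `C_c^∞(ℝ³)` (§1 p.1 l.31–41) does not hold. [cite: Alneel2026, §1 p.1 l.31–41]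
[cite: FeffermanClay2006, (4) p.1] -/
theorem not_clayDelta : ¬ Literature.Claims.NS.Alneel2026.ClayDelta :=
  fun h => not_hasCompactSupport_swirl0 (h swirl0 isDatum_swirl0)

end Summit.NavierStokesRegularity.NavierStokesRegularity.Theorems.Alneel2026ClayDelta

end
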